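import Summits.Langlands.Langlands.Theorems.PhantomRMYoshidaResiduallyYoshidaLiftingRibetIterate
import Summits.Langlands.Langlands.Theorems.PhantomRMYoshidaResiduallyYoshidaLiftingRibetLift
import Mathlib.LinearAlgebra.Finsupp.LinearCombination
import Mathlib.Data.Matrix.Basis
import HarnessLib

/-!
# Ribet's non-split lattice over `ℤ̄_p` — IV. Burnside's contradiction, the core theorem, the rescaled frame

Lead prover-line-stmt-Langlands-13639-c2-0 (line `sector-klingen-split`, crux `ResiduallyYoshidaLifting`,
stmt-Langlands-13639), toward the registered stub `stub_ribetNonsplitLattice` (census §7 R1(a)).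
`false_of_span_of_small_defect`: a cross matrix unit in the `K`-span of the block matrices `M γ` forbids
uniformly small defects (the defect is LINEAR in `M`, and the defect of `E_{(inl i₀),(inr j₀)}` is `E_{i₀ j₀}`).
`exists_nonsplit_pivot` (CORE): for `ρ : Γ → GL(m ⊕ n, 𝒪)` (compact `Γ`, continuous entries, residually zero
lower-left block, matrices spanning `M(K)` — Burnside) some rescaled defect is NOT a residual coboundary, else
file III contradicts the previous lemma.  `exists_rescaled_frame` / `exists_nonsplit_frame`: conjugating by
`Q = (t·1, W; 0, 1)` gives an INTEGRAL homomorphism with block upper triangular reduction `(Ā, b; 0, D̄)`, `b`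
not a residual coboundary.  Refs: Ribet 1976 Prop. 2.1; Bellaïche–Chenevier 2009 Thm. 1.5.5; Burnside.
-/

noncomputable section

open scoped MatrixGroups
open Matrix IsLocalRing

-- `Summit.Langlands.Langlands.…` (summit = sub-problem name, D-0017 layout) trips `dupNamespace` on every decl.
set_option linter.dupNamespace false
set_option autoImplicit false

namespace Summit.Langlands.Langlands.Cruxes.ResiduallyYoshidaLifting.SectorKlingenSplit.Ribet

open Summit.Langlands.Langlands.Cruxes.ResiduallyYoshidaLifting.EndoscopicCrossingEuler
section Burnside

/-- The defect is additive in the block matrix. [folklore] -/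
theorem defect_add_left {R : Type*} [CommRing R] {m n : Type*} [Fintype m] [Fintype n]
    (M N : Matrix (m ⊕ n) (m ⊕ n) R) (W : Matrix m n R) : defect (M + N) W = defect M W + defect N W := by
  have h11 : (M + N).toBlocks₁₁ = M.toBlocks₁₁ + N.toBlocks₁₁ := rfl
  have h12 : (M + N).toBlocks₁₂ = M.toBlocks₁₂ + N.toBlocks₁₂ := rfl
  have h21 : (M + N).toBlocks₂₁ = M.toBlocks₂₁ + N.toBlocks₂₁ := rfl
  have h22 : (M + N).toBlocks₂₂ = M.toBlocks₂₂ + N.toBlocks₂₂ := rfl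
  simp only [defect, h11, h12, h21, h22, Matrix.add_mul, Matrix.mul_add]
  abel

/-- The defect is homogeneous in the block matrix. [folklore] -/
theorem defect_smul_left {R : Type*} [CommRing R] {m n : Type*} [Fintype m] [Fintype n] (a : R)
    (M : Matrix (m ⊕ n) (m ⊕ n) R) (W : Matrix m n R) : defect (a • M) W = a • defect M W := by
  have h11 : (a • M).toBlocks₁₁ = a • M.toBlocks₁₁ := rfl
  have h12 : (a • M).toBlocks₁₂ = a • M.toBlocks₁₂ := rfl
  have h21 : (a • M).toBlocks₂₁ = a • M.toBlocks₂₁ := rfl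
  have h22 : (a • M).toBlocks₂₂ = a • M.toBlocks₂₂ := rfl
  simp only [defect, h11, h12, h21, h22, Matrix.smul_mul, Matrix.mul_smul, smul_sub, smul_add]

/-- The defect of a finitely supported linear combination (linearity in the block matrix). [folklore] -/
theorem defect_finsuppSum {R : Type*} [CommRing R] {Γ m n : Type*} [Fintype m] [Fintype n]
    (c : Γ →₀ R) (M : Γ → Matrix (m ⊕ n) (m ⊕ n) R) (W : Matrix m n R) :
    defect (c.sum fun γ a => a • M γ) W = c.sum fun γ a => a • defect (M γ) W := by
  let L : Matrix (m ⊕ n) (m ⊕ n) R →ₗ[R] Matrix m n R :=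
    { toFun := fun N => defect N W
      map_add' := fun N N' => defect_add_left N N' W
      map_smul' := fun a N => defect_smul_left a N W }
  have hL : ∀ N, defect N W = L N := fun N => rfl
  rw [hL, map_finsuppSum]
  refine Finsupp.sum_congr fun γ _ => ?_
  rw [map_smul, ← hL]

/-- The defect of the cross matrix unit `E_{(inl i₀),(inr j₀)}` is the matrix unit `E_{i₀ j₀}`. [folklore] -/
theorem defect_single {R : Type*} [CommRing R] {m n : Type*} [Fintype m] [Fintype n] [DecidableEq m]
    [DecidableEq n] (i₀ : m) (j₀ : n) (W : Matrix m n R) :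
    defect (Matrix.single (Sum.inl i₀) (Sum.inr j₀) (1 : R) : Matrix (m ⊕ n) (m ⊕ n) R) W =
      Matrix.single i₀ j₀ 1 := by
  have h11 : (Matrix.single (Sum.inl i₀) (Sum.inr j₀) (1 : R) : Matrix (m ⊕ n) (m ⊕ n) R).toBlocks₁₁ = 0 := by
    ext a b; simp [Matrix.toBlocks₁₁]
  have h12 : (Matrix.single (Sum.inl i₀) (Sum.inr j₀) (1 : R) : Matrix (m ⊕ n) (m ⊕ n) R).toBlocks₁₂ =
      Matrix.single i₀ j₀ 1 := by
    ext a b; simp [Matrix.toBlocks₁₂, Matrix.single_apply]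
  have h21 : (Matrix.single (Sum.inl i₀) (Sum.inr j₀) (1 : R) : Matrix (m ⊕ n) (m ⊕ n) R).toBlocks₂₁ = 0 := by
    ext a b; simp [Matrix.toBlocks₂₁]
  have h22 : (Matrix.single (Sum.inl i₀) (Sum.inr j₀) (1 : R) : Matrix (m ⊕ n) (m ⊕ n) R).toBlocks₂₂ = 0 := by
    ext a b; simp [Matrix.toBlocks₂₂]
  simp [defect, h11, h12, h21, h22]

/-- **Burnside's contradiction.**  If the cross matrix unit `E_{(inl i₀),(inr j₀)}` lies in the `K`-span of the
family `M γ` (e.g. the family spans everything, by Burnside's theorem for an irreducible representation over an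
algebraically closed field), then the defects `defect (M γ) W` cannot be made uniformly small at `(i₀, j₀)`.
[folklore] -/
theorem false_of_span_of_small_defect {K : Type*} [NormedField K] {Γ m n : Type*} [Fintype m] [Fintype n]
    [DecidableEq m] [DecidableEq n] (M : Γ → Matrix (m ⊕ n) (m ⊕ n) K) (i₀ : m) (j₀ : n)
    (hspan : (Matrix.single (Sum.inl i₀) (Sum.inr j₀) (1 : K) : Matrix (m ⊕ n) (m ⊕ n) K) ∈
      Submodule.span K (Set.range M))
    (hsmall : ∀ ε : ℝ, 0 < ε → ∃ W : Matrix m n K, ∀ γ, ‖defect (M γ) W i₀ j₀‖ < ε) : False := by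
  classical
  obtain ⟨c, hc⟩ := (Finsupp.mem_span_range_iff_exists_finsupp).1 hspan
  set C : ℝ := ∑ γ ∈ c.support, ‖c γ‖ with hCdef
  have hC0 : 0 ≤ C := Finset.sum_nonneg fun _ _ => norm_nonneg _
  obtain ⟨W, hW⟩ := hsmall (1 / (C + 1)) (by positivity)
  have key : (1 : K) = ∑ γ ∈ c.support, c γ * defect (M γ) W i₀ j₀ := by
    have h1 : defect (c.sum fun γ a => a • M γ) W = Matrix.single i₀ j₀ 1 := by rw [hc, defect_single]
    have h2 := defect_finsuppSum c M W
    have h3 := congrFun (congrFun (h1.symm.trans h2) i₀) j₀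
    simpa [Finsupp.sum, Matrix.sum_apply, Matrix.smul_apply, smul_eq_mul] using h3
  have hle : ‖(1 : K)‖ ≤ C * (1 / (C + 1)) := by
    rw [key]
    refine (norm_sum_le _ _).trans ?_
    calc ∑ γ ∈ c.support, ‖c γ * defect (M γ) W i₀ j₀‖
        = ∑ γ ∈ c.support, ‖c γ‖ * ‖defect (M γ) W i₀ j₀‖ := by simp_rw [norm_mul]
      _ ≤ ∑ γ ∈ c.support, ‖c γ‖ * (1 / (C + 1)) :=
          Finset.sum_le_sum fun γ _ => mul_le_mul_of_nonneg_left (hW γ).le (norm_nonneg _)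
      _ = C * (1 / (C + 1)) := by rw [Finset.sum_mul]
  rw [norm_one] at hle
  have hlt : C * (1 / (C + 1)) < 1 := by
    rw [mul_one_div, div_lt_one (by linarith)]
    linarith
  linarith

end Burnside

section Core

variable {p : ℕ} [Fact p.Prime]

/-- **Core theorem (Ribet's lemma over `ℤ̄_p`, matrix form).**  Let `Γ` be a compact group and
`ρ : Γ → GL(m ⊕ n, 𝒪)` a homomorphism with continuous entries, residually block upper triangular from below
(`res C = 0`), whose matrices span `M_{m⊕n}(K)` over `K = ℚ̄_p` (Burnside: irreducibility).  Then there are an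
integral `W`, a pivot `t ≠ 0` and integral `Φd g` with `defect (ρ g) W = t • Φd g` for all `g`, such that
`res ∘ Φd` is NOT a residual coboundary `Ā X - X D̄`.  Proof: otherwise `exists_small_defect` contradicts
`false_of_span_of_small_defect`. [folklore] -/
theorem exists_nonsplit_pivot {Γ : Type*} [Group Γ] [TopologicalSpace Γ] [CompactSpace Γ] {m n : Type*}
    [Fintype m] [Fintype n] [DecidableEq m] [DecidableEq n] [Nonempty m] [Nonempty n]
    (ρ : Γ →* GL (m ⊕ n) (Valued.integer (PadicAlgCl p)))
    (hρ : ∀ i j, Continuous fun g => (((ρ g : GL (m ⊕ n) (Valued.integer (PadicAlgCl p))) :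
      Matrix (m ⊕ n) (m ⊕ n) (Valued.integer (PadicAlgCl p))) i j : PadicAlgCl p))
    (hC : ∀ g, ((ρ g : GL (m ⊕ n) (Valued.integer (PadicAlgCl p))) :
      Matrix (m ⊕ n) (m ⊕ n) (Valued.integer (PadicAlgCl p))).toBlocks₂₁.map
        (residue (Valued.integer (PadicAlgCl p))) = 0)
    (hspan : Submodule.span (PadicAlgCl p) (Set.range fun g =>
      ((ρ g : GL (m ⊕ n) (Valued.integer (PadicAlgCl p))) :
        Matrix (m ⊕ n) (m ⊕ n) (Valued.integer (PadicAlgCl p))).map (Valued.integer (PadicAlgCl p)).subtype) = ⊤) :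
    ∃ (W : Matrix m n (Valued.integer (PadicAlgCl p))) (t : Valued.integer (PadicAlgCl p))
      (Φd : Γ → Matrix m n (Valued.integer (PadicAlgCl p))), t ≠ 0 ∧
      (∀ g, defect ((ρ g : GL (m ⊕ n) (Valued.integer (PadicAlgCl p))) :
        Matrix (m ⊕ n) (m ⊕ n) (Valued.integer (PadicAlgCl p))) W = t • Φd g) ∧
      ¬ ∃ X : Matrix m n (ResidueField (Valued.integer (PadicAlgCl p))), ∀ g,
        (Φd g).map (residue (Valued.integer (PadicAlgCl p))) =
          ((ρ g : GL (m ⊕ n) (Valued.integer (PadicAlgCl p))) :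
            Matrix (m ⊕ n) (m ⊕ n) (Valued.integer (PadicAlgCl p))).toBlocks₁₁.map
              (residue (Valued.integer (PadicAlgCl p))) * X -
          X * ((ρ g : GL (m ⊕ n) (Valued.integer (PadicAlgCl p))) :
            Matrix (m ⊕ n) (m ⊕ n) (Valued.integer (PadicAlgCl p))).toBlocks₂₂.map
              (residue (Valued.integer (PadicAlgCl p))) := by
  classical
  set R : Γ → Matrix (m ⊕ n) (m ⊕ n) (Valued.integer (PadicAlgCl p)) :=
    fun g => ((ρ g : GL (m ⊕ n) (Valued.integer (PadicAlgCl p))) :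
      Matrix (m ⊕ n) (m ⊕ n) (Valued.integer (PadicAlgCl p))) with hR
  by_contra hneg
  push Not at hneg
  -- hypothesis (H) of `exists_small_defect`: every rescaled defect is a residual coboundary (lifted to `𝒪`)
  have H : ∀ (W : Matrix m n (Valued.integer (PadicAlgCl p))) (t : Valued.integer (PadicAlgCl p))
      (Φd : Γ → Matrix m n (Valued.integer (PadicAlgCl p))), t ≠ 0 → (∀ g, defect (R g) W = t • Φd g) →
      ∃ X : Matrix m n (Valued.integer (PadicAlgCl p)), ∀ g,
        (Φd g).map (residue (Valued.integer (PadicAlgCl p))) =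
          (R g).toBlocks₁₁.map (residue (Valued.integer (PadicAlgCl p))) *
              X.map (residue (Valued.integer (PadicAlgCl p))) -
            X.map (residue (Valued.integer (PadicAlgCl p))) *
              (R g).toBlocks₂₂.map (residue (Valued.integer (PadicAlgCl p))) := by
    intro W t Φd ht hΦ
    obtain ⟨Xbar, hXbar⟩ := hneg W t Φd ht hΦ
    choose f hf using (residue_surjective (R := Valued.integer (PadicAlgCl p)))
    refine ⟨Xbar.map f, fun g => ?_⟩
    have hlift : (Xbar.map f).map (residue (Valued.integer (PadicAlgCl p))) = Xbar := by
      ext a b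
      exact hf _
    rw [hlift]
    exact hXbar g
  -- a cross matrix unit in the span
  obtain ⟨i₀⟩ := ‹Nonempty m›
  obtain ⟨j₀⟩ := ‹Nonempty n›
  refine false_of_span_of_small_defect (fun g => (R g).map (Valued.integer (PadicAlgCl p)).subtype) i₀ j₀
    (by rw [hspan]; exact Submodule.mem_top) fun ε hε => ?_
  obtain ⟨W, hW⟩ := exists_small_defect ρ hρ hC H hε
  refine ⟨W.map (Valued.integer (PadicAlgCl p)).subtype, fun g => ?_⟩
  rw [← defect_map]
  exact hW g i₀ j₀

/-- The block computation behind the rescaled frame: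
`(t⁻¹·1, -t⁻¹W; 0, 1) · (A, B; C, D) · (t·1, W; 0, 1) = (A - W C, t⁻¹ Φ_W; t C, D + C W)`. [folklore] -/
theorem rescale_conj_fromBlocks {K : Type*} [Field K] {m n : Type*} [Fintype m] [Fintype n] [DecidableEq m]
    [DecidableEq n] (A : Matrix m m K) (B : Matrix m n K) (C : Matrix n m K) (D : Matrix n n K)
    (W : Matrix m n K) {t : K} (ht : t ≠ 0) :
    Matrix.fromBlocks (t⁻¹ • (1 : Matrix m m K)) (-(t⁻¹ • W)) 0 1 * Matrix.fromBlocks A B C D *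
        Matrix.fromBlocks (t • (1 : Matrix m m K)) W 0 1 =
      Matrix.fromBlocks (A - W * C) (t⁻¹ • (B + A * W - W * D - W * C * W)) (t • C) (D + C * W) := by
  rw [Matrix.fromBlocks_multiply, Matrix.fromBlocks_multiply]
  simp only [Matrix.smul_mul, Matrix.mul_smul, Matrix.one_mul, Matrix.mul_one, Matrix.mul_zero,
    Matrix.zero_mul, add_zero, zero_add, Matrix.neg_mul, Matrix.add_mul, smul_add, smul_neg, smul_smul,
    mul_inv_cancel₀ ht, one_smul, smul_sub]
  congr 1 <;> abel

/-- **The rescaled frame.**  Given an integral `W`, a pivot `t ≠ 0` and `Φd` with `defect (ρ g) W = t • Φd g`,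
conjugation by `Q = (t·1, W; 0, 1) ∈ GL(m ⊕ n, K)` yields an INTEGRAL homomorphism `ρ'` with blocks
`(A - W C, Φd; t C, D + C W)`. [folklore] -/
theorem exists_rescaled_frame {Γ : Type*} [Group Γ] {m n : Type*} [Fintype m] [Fintype n] [DecidableEq m]
    [DecidableEq n] (ρ : Γ →* GL (m ⊕ n) (Valued.integer (PadicAlgCl p)))
    (W : Matrix m n (Valued.integer (PadicAlgCl p))) (t : Valued.integer (PadicAlgCl p))
    (Φd : Γ → Matrix m n (Valued.integer (PadicAlgCl p))) (ht : t ≠ 0)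
    (hΦ : ∀ g, defect ((ρ g : GL (m ⊕ n) (Valued.integer (PadicAlgCl p))) :
      Matrix (m ⊕ n) (m ⊕ n) (Valued.integer (PadicAlgCl p))) W = t • Φd g) :
    ∃ (Q : GL (m ⊕ n) (PadicAlgCl p)) (ρ' : Γ →* GL (m ⊕ n) (Valued.integer (PadicAlgCl p))),
      (∀ g, Matrix.GeneralLinearGroup.map (Valued.integer (PadicAlgCl p)).subtype (ρ' g) =
        Q⁻¹ * Matrix.GeneralLinearGroup.map (Valued.integer (PadicAlgCl p)).subtype (ρ g) * Q) ∧
      (Q : Matrix (m ⊕ n) (m ⊕ n) (PadicAlgCl p)) =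
        Matrix.fromBlocks ((t : PadicAlgCl p) • (1 : Matrix m m (PadicAlgCl p)))
          (W.map (Valued.integer (PadicAlgCl p)).subtype) 0 1 ∧
      ∀ g, ((ρ' g : GL (m ⊕ n) (Valued.integer (PadicAlgCl p))) :
          Matrix (m ⊕ n) (m ⊕ n) (Valued.integer (PadicAlgCl p))) =
        Matrix.fromBlocks
          (((ρ g : GL (m ⊕ n) (Valued.integer (PadicAlgCl p))) :
              Matrix (m ⊕ n) (m ⊕ n) (Valued.integer (PadicAlgCl p))).toBlocks₁₁ -
            W * ((ρ g : GL (m ⊕ n) (Valued.integer (PadicAlgCl p))) :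
              Matrix (m ⊕ n) (m ⊕ n) (Valued.integer (PadicAlgCl p))).toBlocks₂₁)
          (Φd g)
          (t • ((ρ g : GL (m ⊕ n) (Valued.integer (PadicAlgCl p))) :
              Matrix (m ⊕ n) (m ⊕ n) (Valued.integer (PadicAlgCl p))).toBlocks₂₁)
          (((ρ g : GL (m ⊕ n) (Valued.integer (PadicAlgCl p))) :
              Matrix (m ⊕ n) (m ⊕ n) (Valued.integer (PadicAlgCl p))).toBlocks₂₂ +
            ((ρ g : GL (m ⊕ n) (Valued.integer (PadicAlgCl p))) :
              Matrix (m ⊕ n) (m ⊕ n) (Valued.integer (PadicAlgCl p))).toBlocks₂₁ * W) := by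
  classical
  set R : Γ → Matrix (m ⊕ n) (m ⊕ n) (Valued.integer (PadicAlgCl p)) :=
    fun g => ((ρ g : GL (m ⊕ n) (Valued.integer (PadicAlgCl p))) :
      Matrix (m ⊕ n) (m ⊕ n) (Valued.integer (PadicAlgCl p))) with hR
  set ι := (Valued.integer (PadicAlgCl p)).subtype with hι
  have ht' : (t : PadicAlgCl p) ≠ 0 := fun h0 => ht (Subtype.ext h0)
  set tK : PadicAlgCl p := (t : PadicAlgCl p) with htK
  set Wv : Matrix m n (PadicAlgCl p) := W.map ι with hWv
  -- the conjugating matrix `Q = (t·1, W; 0, 1)` and its inverse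
  let Q : GL (m ⊕ n) (PadicAlgCl p) :=
    ⟨Matrix.fromBlocks (tK • (1 : Matrix m m (PadicAlgCl p))) Wv 0 1,
     Matrix.fromBlocks (tK⁻¹ • (1 : Matrix m m (PadicAlgCl p))) (-(tK⁻¹ • Wv)) 0 1,
     by
      rw [Matrix.fromBlocks_multiply]
      simp [Matrix.smul_mul, Matrix.mul_smul, smul_smul, inv_mul_cancel₀ ht', Matrix.fromBlocks_one],
     by
      rw [Matrix.fromBlocks_multiply]
      simp [Matrix.smul_mul, Matrix.mul_smul, smul_smul, mul_inv_cancel₀ ht', Matrix.fromBlocks_one]⟩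
  have hQ : (Q : Matrix (m ⊕ n) (m ⊕ n) (PadicAlgCl p)) =
      Matrix.fromBlocks (tK • (1 : Matrix m m (PadicAlgCl p))) Wv 0 1 := rfl
  have hQinv : ((Q⁻¹ : GL (m ⊕ n) (PadicAlgCl p)) : Matrix (m ⊕ n) (m ⊕ n) (PadicAlgCl p)) =
      Matrix.fromBlocks (tK⁻¹ • (1 : Matrix m m (PadicAlgCl p))) (-(tK⁻¹ • Wv)) 0 1 := rfl
  -- the target integral matrices
  let N : Γ → Matrix (m ⊕ n) (m ⊕ n) (Valued.integer (PadicAlgCl p)) := fun g =>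
    Matrix.fromBlocks ((R g).toBlocks₁₁ - W * (R g).toBlocks₂₁) (Φd g) (t • (R g).toBlocks₂₁)
      ((R g).toBlocks₂₂ + (R g).toBlocks₂₁ * W)
  -- the conjugate homomorphism over `K`
  let ρK : Γ →* GL (m ⊕ n) (PadicAlgCl p) := (Matrix.GeneralLinearGroup.map ι).comp ρ
  let φ : Γ →* GL (m ⊕ n) (PadicAlgCl p) := (MulAut.conj Q⁻¹).toMonoidHom.comp ρK
  have hφ : ∀ g, φ g = Q⁻¹ * ρK g * Q := fun g => by simp [φ, mul_assoc]
  have hρK : ∀ g, ((ρK g : GL (m ⊕ n) (PadicAlgCl p)) : Matrix (m ⊕ n) (m ⊕ n) (PadicAlgCl p)) =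
      (R g).map ι := fun g => rfl
  -- block computation of `φ g`
  have hsm : ∀ a : Valued.integer (PadicAlgCl p), ι (t • a) = tK • ι a := fun a => by
    simp [hι, htK, smul_eq_mul]
  have hφval : ∀ g, ((φ g : GL (m ⊕ n) (PadicAlgCl p)) : Matrix (m ⊕ n) (m ⊕ n) (PadicAlgCl p)) =
      (N g).map ι := by
    intro g
    have hΦg : (Φd g).map ι = tK⁻¹ • defect ((R g).map ι) Wv := by
      have h1 : (defect (R g) W).map ι = (t • Φd g).map ι := by rw [hΦ g]
      rw [defect_map, Matrix.map_smulₛₗ _ (fun _ => tK) t hsm (Φd g)] at h1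
      rw [hWv, h1, smul_smul, inv_mul_cancel₀ ht', one_smul]
    rw [hφ, Units.val_mul, Units.val_mul, hQinv, hQ, hρK]
    conv_lhs => rw [← Matrix.fromBlocks_toBlocks ((R g).map ι)]
    rw [rescale_conj_fromBlocks _ _ _ _ _ ht']
    simp only [N, Matrix.fromBlocks_map]
    rw [Matrix.map_sub _ (map_sub ι), Matrix.map_add _ (map_add ι), Matrix.map_mul, Matrix.map_mul,
      Matrix.map_smulₛₗ _ (fun _ => tK) t hsm, hΦg, toBlocks₁₁_map, toBlocks₁₂_map, toBlocks₂₁_map,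
      toBlocks₂₂_map, ← hWv]
    rfl
  -- `φ` is integral, hence lifts to `GL(𝒪)`
  have hmem : ∀ g, φ g ∈ (Matrix.GeneralLinearGroup.map (n := m ⊕ n) ι).range := by
    intro g
    rw [mem_range_map_subtype_iff]
    constructor
    · intro i j
      rw [hφval]
      exact SetLike.coe_mem _
    · intro i j
      rw [← map_inv, hφval]
      exact SetLike.coe_mem _
  obtain ⟨ρ', hρ'⟩ := exists_monoidHom_map_eq' φ hmem
  refine ⟨Q, ρ', fun g => (hρ' g).trans (hφ g), hQ, fun g => ?_⟩
  have h1 : (((ρ' g : GL (m ⊕ n) (Valued.integer (PadicAlgCl p))) :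
      Matrix (m ⊕ n) (m ⊕ n) (Valued.integer (PadicAlgCl p))).map ι) = (N g).map ι := by
    rw [← hφval, ← hρ' g]
    rfl
  exact Matrix.ext fun i j => Subtype.ext (congrFun (congrFun h1 i) j)

/-- The reduction of the rescaled frame is block upper triangular `(Ā, res Φd; 0, D̄)`. [folklore] -/
theorem map_residue_rescaled {m n : Type*} [Fintype m] [Fintype n]
    (M : Matrix (m ⊕ n) (m ⊕ n) (Valued.integer (PadicAlgCl p)))
    (hC : M.toBlocks₂₁.map (residue (Valued.integer (PadicAlgCl p))) = 0)
    (W Φ : Matrix m n (Valued.integer (PadicAlgCl p))) (t : Valued.integer (PadicAlgCl p)) :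
    (Matrix.fromBlocks (M.toBlocks₁₁ - W * M.toBlocks₂₁) Φ (t • M.toBlocks₂₁) (M.toBlocks₂₂ + M.toBlocks₂₁ * W)).map
        (residue (Valued.integer (PadicAlgCl p))) =
      Matrix.fromBlocks (M.toBlocks₁₁.map (residue (Valued.integer (PadicAlgCl p))))
        (Φ.map (residue (Valued.integer (PadicAlgCl p)))) 0
        (M.toBlocks₂₂.map (residue (Valued.integer (PadicAlgCl p)))) := by
  rw [Matrix.fromBlocks_map, Matrix.map_sub _ (map_sub _), Matrix.map_add _ (map_add _), Matrix.map_mul,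
    Matrix.map_mul, map_residue_smul, hC]
  simp

end Core

section Frame

variable {p : ℕ} [Fact p.Prime]

/-- **Ribet's non-split lattice, matrix form over `ℤ̄_p`.**  Under the hypotheses of `exists_nonsplit_pivot`,
some `GL(K)`-conjugate `ρ'` of `ρ` is integral with block UPPER triangular reduction `(Ā, b; 0, D̄)` (same
diagonal blocks as `ρ`) whose corner `b` is NOT a residual coboundary `Ā X - X D̄`. [folklore] -/
theorem exists_nonsplit_frame {Γ : Type*} [Group Γ] [TopologicalSpace Γ] [CompactSpace Γ] {m n : Type*}
    [Fintype m] [Fintype n] [DecidableEq m] [DecidableEq n] [Nonempty m] [Nonempty n]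
    (ρ : Γ →* GL (m ⊕ n) (Valued.integer (PadicAlgCl p)))
    (hρ : ∀ i j, Continuous fun g => (((ρ g : GL (m ⊕ n) (Valued.integer (PadicAlgCl p))) :
      Matrix (m ⊕ n) (m ⊕ n) (Valued.integer (PadicAlgCl p))) i j : PadicAlgCl p))
    (hC : ∀ g, ((ρ g : GL (m ⊕ n) (Valued.integer (PadicAlgCl p))) :
      Matrix (m ⊕ n) (m ⊕ n) (Valued.integer (PadicAlgCl p))).toBlocks₂₁.map
        (residue (Valued.integer (PadicAlgCl p))) = 0)
    (hspan : Submodule.span (PadicAlgCl p) (Set.range fun g =>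
      ((ρ g : GL (m ⊕ n) (Valued.integer (PadicAlgCl p))) :
        Matrix (m ⊕ n) (m ⊕ n) (Valued.integer (PadicAlgCl p))).map (Valued.integer (PadicAlgCl p)).subtype) = ⊤) :
    ∃ (Q : GL (m ⊕ n) (PadicAlgCl p)) (ρ' : Γ →* GL (m ⊕ n) (Valued.integer (PadicAlgCl p)))
      (b : Γ → Matrix m n (ResidueField (Valued.integer (PadicAlgCl p)))),
      (∀ g, Matrix.GeneralLinearGroup.map (Valued.integer (PadicAlgCl p)).subtype (ρ' g) =
        Q⁻¹ * Matrix.GeneralLinearGroup.map (Valued.integer (PadicAlgCl p)).subtype (ρ g) * Q) ∧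
      (∀ g, ((ρ' g : GL (m ⊕ n) (Valued.integer (PadicAlgCl p))) :
          Matrix (m ⊕ n) (m ⊕ n) (Valued.integer (PadicAlgCl p))).map (residue (Valued.integer (PadicAlgCl p))) =
        Matrix.fromBlocks
          (((ρ g : GL (m ⊕ n) (Valued.integer (PadicAlgCl p))) :
            Matrix (m ⊕ n) (m ⊕ n) (Valued.integer (PadicAlgCl p))).toBlocks₁₁.map
              (residue (Valued.integer (PadicAlgCl p))))
          (b g) 0
          (((ρ g : GL (m ⊕ n) (Valued.integer (PadicAlgCl p))) :
            Matrix (m ⊕ n) (m ⊕ n) (Valued.integer (PadicAlgCl p))).toBlocks₂₂.map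
              (residue (Valued.integer (PadicAlgCl p))))) ∧
      ¬ ∃ X : Matrix m n (ResidueField (Valued.integer (PadicAlgCl p))), ∀ g,
        b g = ((ρ g : GL (m ⊕ n) (Valued.integer (PadicAlgCl p))) :
            Matrix (m ⊕ n) (m ⊕ n) (Valued.integer (PadicAlgCl p))).toBlocks₁₁.map
              (residue (Valued.integer (PadicAlgCl p))) * X -
          X * ((ρ g : GL (m ⊕ n) (Valued.integer (PadicAlgCl p))) :
            Matrix (m ⊕ n) (m ⊕ n) (Valued.integer (PadicAlgCl p))).toBlocks₂₂.map
              (residue (Valued.integer (PadicAlgCl p))) := by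
  obtain ⟨W, t, Φd, ht, hΦ, hnc⟩ := exists_nonsplit_pivot ρ hρ hC hspan
  obtain ⟨Q, ρ', hρ', -, hblocks⟩ := exists_rescaled_frame ρ W t Φd ht hΦ
  refine ⟨Q, ρ', fun g => (Φd g).map (residue (Valued.integer (PadicAlgCl p))), hρ', fun g => ?_, hnc⟩
  rw [hblocks g]
  exact map_residue_rescaled _ (hC g) W (Φd g) t

end Frame

/-- **Registered statement `stub_ribetNonsplitFrame`** (wrapper of `exists_nonsplit_frame` with explicit binders,
the form recorded on the crux item). [folklore] -/
theorem stub_ribetNonsplitFrame :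
    ∀ (p : ℕ) [Fact p.Prime] (Γ : Type) [Group Γ] [TopologicalSpace Γ] [CompactSpace Γ] (m n : Type)
      [Fintype m] [Fintype n] [DecidableEq m] [DecidableEq n] [Nonempty m] [Nonempty n]
      (ρ : Γ →* GL (m ⊕ n) (Valued.integer (PadicAlgCl p))),
      (∀ i j, Continuous fun g => (((ρ g : GL (m ⊕ n) (Valued.integer (PadicAlgCl p))) :
        Matrix (m ⊕ n) (m ⊕ n) (Valued.integer (PadicAlgCl p))) i j : PadicAlgCl p)) →
      (∀ g, ((ρ g : GL (m ⊕ n) (Valued.integer (PadicAlgCl p))) :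
        Matrix (m ⊕ n) (m ⊕ n) (Valued.integer (PadicAlgCl p))).toBlocks₂₁.map
          (IsLocalRing.residue (Valued.integer (PadicAlgCl p))) = 0) →
      Submodule.span (PadicAlgCl p) (Set.range fun g =>
        ((ρ g : GL (m ⊕ n) (Valued.integer (PadicAlgCl p))) :
          Matrix (m ⊕ n) (m ⊕ n) (Valued.integer (PadicAlgCl p))).map (Valued.integer (PadicAlgCl p)).subtype) = ⊤ →
      ∃ (Q : GL (m ⊕ n) (PadicAlgCl p)) (ρ' : Γ →* GL (m ⊕ n) (Valued.integer (PadicAlgCl p)))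
        (b : Γ → Matrix m n (IsLocalRing.ResidueField (Valued.integer (PadicAlgCl p)))),
        (∀ g, Matrix.GeneralLinearGroup.map (Valued.integer (PadicAlgCl p)).subtype (ρ' g) =
          Q⁻¹ * Matrix.GeneralLinearGroup.map (Valued.integer (PadicAlgCl p)).subtype (ρ g) * Q) ∧
        (∀ g, ((ρ' g : GL (m ⊕ n) (Valued.integer (PadicAlgCl p))) :
            Matrix (m ⊕ n) (m ⊕ n) (Valued.integer (PadicAlgCl p))).map
              (IsLocalRing.residue (Valued.integer (PadicAlgCl p))) =
          Matrix.fromBlocks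
            (((ρ g : GL (m ⊕ n) (Valued.integer (PadicAlgCl p))) :
              Matrix (m ⊕ n) (m ⊕ n) (Valued.integer (PadicAlgCl p))).toBlocks₁₁.map
                (IsLocalRing.residue (Valued.integer (PadicAlgCl p))))
            (b g) 0
            (((ρ g : GL (m ⊕ n) (Valued.integer (PadicAlgCl p))) :
              Matrix (m ⊕ n) (m ⊕ n) (Valued.integer (PadicAlgCl p))).toBlocks₂₂.map
                (IsLocalRing.residue (Valued.integer (PadicAlgCl p))))) ∧
        ¬ ∃ X : Matrix m n (IsLocalRing.ResidueField (Valued.integer (PadicAlgCl p))), ∀ g,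
          b g = ((ρ g : GL (m ⊕ n) (Valued.integer (PadicAlgCl p))) :
              Matrix (m ⊕ n) (m ⊕ n) (Valued.integer (PadicAlgCl p))).toBlocks₁₁.map
                (IsLocalRing.residue (Valued.integer (PadicAlgCl p))) * X -
            X * ((ρ g : GL (m ⊕ n) (Valued.integer (PadicAlgCl p))) :
              Matrix (m ⊕ n) (m ⊕ n) (Valued.integer (PadicAlgCl p))).toBlocks₂₂.map
                (IsLocalRing.residue (Valued.integer (PadicAlgCl p))) := by
  intro p _ Γ _ _ _ m n _ _ _ _ _ _ ρ hρ hC hspan; exact exists_nonsplit_frame ρ hρ hC hspan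
end Summit.Langlands.Langlands.Cruxes.ResiduallyYoshidaLifting.SectorKlingenSplit.Ribet
end
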